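import Literature.Topology.FourManifolds.KirbyMovesBlowDown
import Literature.Topology.FourManifolds.BlowDownFlatModel
import Literature.Topology.FourManifolds.TubularNbhdOfLocalDiffeomorph
import Literature.Topology.FourManifolds.KirbyMovesReverseProofs
import Mathlib.Analysis.Convex.Contractible
import Mathlib.AlgebraicTopology.FundamentalGroupoid.SimplyConnected
import HarnessLib

/-!
# The blow-down model in `S³`: `±1`-surgery on a disc-bounding knot, relative to the disc

Topic `Literature/Topology/FourManifolds`; third step towards leaf **(C)**
`Literature.Topology.FourManifolds.Knot.blowDownModel` (`KirbyMovesBlowDown.lean`) of the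
blow-down invariance of surgery (`FramedLink.IsBlowDown.isSurgery`; R. C. Kirby, *The Topology of
4-Manifolds*, LNM 1374 (1989), Ch. I §5, Thm. 5.1, move (2); Rolfsen, *Knots and Links* (1976),
§9.H). The flat model of `BlowDownFlatModel.lean` (an explicit presentation of `ℝ³` as
`ε`-surgery on the flat unit circle, standard off any neighbourhood of the flat disc) is
transported to `S³` along a **flattening chart** of the knot — an injective local diffeomorphism
`Γ` of an open neighbourhood `Ω ⊆ ℝ³` of the flat closed unit disc into `S³` carrying the flat
unit circle onto `K` (`Knot.FlatChart`). Everything in this file is proved; the outcome is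

* `Knot.FlatChart.blowDownModel` — the conclusion of `Knot.blowDownModel` for a knot with a
  flattening chart whose flat disc maps into the open set `W`;
* `Knot.ExistsFlatChart` (a `Prop`: every smooth spanning disc is flattened by a chart) and
  `Knot.blowDownModel_of_flatCharts : Knot.ExistsFlatChart → Knot.blowDownModel`; the existence
  of flattening charts (thickening the disc along its normal field) is the next file.

## The transport

Given a flattening chart `Φ` and `W ⊇ Γ(flat disc)` open, `ModelData` (`nonempty_modelData`)
chooses a thickness `δ` and a smooth admissible cut-off supported in a compact region
`supp ⊆ Ω ∩ Γ⁻¹ W` (and a box `N_η ⊆ Ω` with `δ ≤ η`). Then: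

* `nbhd` — the oriented tubular neighbourhood `Γ ∘ flatTubeS h δ` with the handedness `h = hand`
  fixed by the orientation of `Γ` (`Knot.TubularNbhd.ofLocalDiffeomorph`,
  `TubularNbhdOfLocalDiffeomorph.lean`; `flatTube_planeFlip`); it has **framing `0`**
  (`hasFraming_nbhd`): its longitude is the `Γ`-image of the circle of radius `1` at height
  `z₀ > 0`, a loop in the convex (hence simply connected) slab `{‖(x, y)‖ < √(1 + η),
  0 < z < 2 z₀} ⊆ Ω ∖ U`; `nbhdε = nbhd.twist ε` has framing `ε` (`HasFraming.twist`,
  `DehnSurgeryTwistProofs.lean`).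
* `sphereTwist s` — `Γ ∘ T_s ∘ Γ⁻¹` on the open punctured image `Γ (Ω ∖ U)`, the identity
  elsewhere; smooth off `K`, inverse `sphereTwist (-s)`, identity off `Γ (supp) ⊆ W`; it restricts
  to a diffeomorphism `complTwist` of the open submanifold `S³ ∖ K`, and `phiMap = ι ∘ complTwist`
  is the gluing map of the knot complement (sign `s = h ε`).
* `psiMap = Γ ∘ psiFlatS` — the new solid torus, a smooth embedding with open range in `W`
  (`isSmoothEmbedding_of_isLocalDiffeomorph`).
* `phiMap_eq_psiMap_iff` — the surgery relation `φ a = ψ b ↔ surgeryRel (nbhdε ε) a b`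
  (the flat `twistMap_eq_psiFlat_iff`, injectivity of `Γ`), and
  `range_phiMap_union_range_psiMap` — the covering (the flat `exists_eq_twistMap_or`).

## References

* R. C. Kirby, *The Topology of 4-Manifolds*, LNM 1374, Springer (1989), Ch. I §5, Thm. 5.1,
  move (2). [cite: Kirby1989, Ch. I §5 Thm 5.1]
* D. Rolfsen, *Knots and Links*, Publish or Perish (1976), §9.H (the `±1` twist along a
  spanning disc). [cite: Rolfsen1976, §9.F]
* M. W. Hirsch, *Differential Topology* (1976), Ch. 4 §5 (tubular neighbourhoods).
  [cite: Hirsch1976, §4.5 Thm 5.2]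

## Design notes

* The chart is a total function with an explicit open domain `Ω` (no subtypes); its inverse on
  `Γ '' Ω` is `Function.invFunOn`, smooth by the local diffeomorphism property and injectivity
  (`Knot.FlatChart.contMDiffOn_inv`).
* `BlowDownFlat.flatDisc` is written qualified (the tree has an unrelated
  `Literature.Topology.FourManifolds.flatDisc` in `SliceRibbon.lean`).
* No declaration in this file uses `sorry`.
-/

open scoped Manifold ContDiff Topology RealInnerProductSpace
open Function Set

noncomputable section

namespace Literature.Topology.FourManifolds

/-- Local notation: `𝔼 n` is the model Euclidean space `EuclideanSpace ℝ (Fin n)`. -/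
local notation "𝔼 " n:arg => EuclideanSpace ℝ (Fin n)

/-- Local notation: `𝕊 n` is the unit sphere in `EuclideanSpace ℝ (Fin (n + 1))`. -/
local notation "𝕊 " n:arg => (Metric.sphere (0 : EuclideanSpace ℝ (Fin (n + 1))) 1)

/-- Local notation: the model with corners of `S¹ × ℝ²`. -/
local notation "𝓘₁₂" => (ModelWithCorners.prod (𝓡 1) 𝓘(ℝ, EuclideanSpace ℝ (Fin 2)))

attribute [local instance] fact_finrank_euclideanSpace_two fact_finrank_euclideanSpace_four

open BlowDownFlat

/-! ### Flattening charts of a disc-bounding knot -/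

/-- A **flattening chart** for the knot `K`: an injective local diffeomorphism `Γ` of an open
neighbourhood `Ω` of the flat closed unit disc of `ℝ³` into `S³` carrying the flat unit circle,
with its parametrisation `u ↦ (u, 0)`, onto `K`. (Produced from a smooth spanning disc of `K` by
thickening it along a normal field; the flat disc is then carried onto the spanning disc.)
[folklore] -/
structure Knot.FlatChart (K : Knot) where
  /-- The open domain, a neighbourhood of the flat closed unit disc. -/
  Ω : Set (𝔼 3)
  isOpen_Ω : IsOpen Ω
  /-- The chart (a total function; only its values on `Ω` matter). -/
  Γ : 𝔼 3 → 𝕊 3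
  isLocalDiffeomorphAt : ∀ p ∈ Ω, IsLocalDiffeomorphAt 𝓘(ℝ, 𝔼 3) (𝓡 3) ∞ Γ p
  injOn : InjOn Γ Ω
  flatDisc_subset : BlowDownFlat.flatDisc ⊆ Ω
  apply_flatCircle : ∀ u, Γ (flatCircle u) = K u

namespace Knot.FlatChart

variable {K : Knot} (Φ : K.FlatChart)

/-- A flattening chart is smooth on its domain. [folklore] -/
theorem contMDiffOn : ContMDiffOn 𝓘(ℝ, 𝔼 3) (𝓡 3) ∞ Φ.Γ Φ.Ω := fun p hp ↦
  (Φ.isLocalDiffeomorphAt p hp).contMDiffAt.contMDiffWithinAt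

/-- A flattening chart is continuous on its domain. [folklore] -/
theorem continuousOn : ContinuousOn Φ.Γ Φ.Ω := Φ.contMDiffOn.continuousOn

/-- A flattening chart is smooth at the points of its domain. [folklore] -/
theorem contMDiffAt {p : 𝔼 3} (hp : p ∈ Φ.Ω) : ContMDiffAt 𝓘(ℝ, 𝔼 3) (𝓡 3) ∞ Φ.Γ p :=
  (Φ.isLocalDiffeomorphAt p hp).contMDiffAt

/-- **A flattening chart is an open map on its domain**: the image of an open subset of `Ω` is
open. [folklore] -/
theorem isOpen_image {U : Set (𝔼 3)} (hU : IsOpen U) (hUΩ : U ⊆ Φ.Ω) : IsOpen (Φ.Γ '' U) := by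
  rw [isOpen_iff_mem_nhds]
  rintro _ ⟨p, hp, rfl⟩
  obtain ⟨e, hpe, heq⟩ := Φ.isLocalDiffeomorphAt p (hUΩ hp)
  have hopen : IsOpen (e.toOpenPartialHomeomorph '' (U ∩ e.source)) :=
    e.toOpenPartialHomeomorph.isOpen_image_of_subset_source (hU.inter e.open_source)
      inter_subset_right
  refine Filter.mem_of_superset (hopen.mem_nhds ⟨p, ⟨hp, hpe⟩, (heq hpe).symm⟩) ?_
  rintro _ ⟨p', ⟨hp'U, hp'e⟩, rfl⟩
  exact ⟨p', hp'U, (heq hp'e).trans rfl⟩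

/-- The image of the domain is open. [folklore] -/
theorem isOpen_image_Ω : IsOpen (Φ.Γ '' Φ.Ω) := Φ.isOpen_image Φ.isOpen_Ω subset_rfl

/-- The flat circle lies in the domain. [folklore] -/
theorem flatCircle_mem (u : 𝕊 1) : flatCircle u ∈ Φ.Ω :=
  Φ.flatDisc_subset ⟨rfl, (sphere_sq u).le⟩

/-- The knot is the image of the flat circle. [folklore] -/
theorem range_knot_eq : range K = Φ.Γ '' range flatCircle := by
  ext y
  constructor
  · rintro ⟨u, rfl⟩
    exact ⟨flatCircle u, mem_range_self u, Φ.apply_flatCircle u⟩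
  · rintro ⟨_, ⟨u, rfl⟩, rfl⟩
    exact ⟨u, (Φ.apply_flatCircle u).symm⟩

/-- **A point of the domain mapped to the knot lies on the flat circle** (injectivity). [folklore] -/
theorem mem_range_flatCircle_of_mem {p : 𝔼 3} (hp : p ∈ Φ.Ω) (hK : Φ.Γ p ∈ range K) :
    p ∈ range flatCircle := by
  rw [Φ.range_knot_eq] at hK
  obtain ⟨q, ⟨u, rfl⟩, hq⟩ := hK
  exact ⟨u, Φ.injOn (Φ.flatCircle_mem u) hp hq⟩

/-- Points of the domain off the flat circle map into the knot complement. [folklore] -/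
theorem apply_mem_compl {p : 𝔼 3} (hp : p ∈ Φ.Ω) (hpU : p ∉ range flatCircle) :
    Φ.Γ p ∈ (range K)ᶜ := fun h ↦ hpU (Φ.mem_range_flatCircle_of_mem hp h)

/-! #### The inverse of a flattening chart on its image -/

/-- The inverse of the chart on `Γ '' Ω` (junk elsewhere). [folklore] -/
def inv : 𝕊 3 → 𝔼 3 := invFunOn Φ.Γ Φ.Ω

/-- The inverse is a left inverse on the domain. [folklore] -/
theorem inv_apply {p : 𝔼 3} (hp : p ∈ Φ.Ω) : Φ.inv (Φ.Γ p) = p :=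
  Φ.injOn.leftInvOn_invFunOn hp

/-- The inverse maps the image into the domain. [folklore] -/
theorem inv_mem {y : 𝕊 3} (hy : y ∈ Φ.Γ '' Φ.Ω) : Φ.inv y ∈ Φ.Ω := by
  obtain ⟨p, hp, rfl⟩ := hy
  rw [Φ.inv_apply hp]; exact hp

/-- The inverse is a right inverse on the image. [folklore] -/
theorem apply_inv {y : 𝕊 3} (hy : y ∈ Φ.Γ '' Φ.Ω) : Φ.Γ (Φ.inv y) = y := by
  obtain ⟨p, hp, rfl⟩ := hy
  rw [Φ.inv_apply hp]

/-- **The inverse of a flattening chart is smooth on the image**: near the image of `p` it agrees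
with the inverse of a partial diffeomorphism witnessing the local diffeomorphism property at `p`,
restricted to `Ω` (injectivity on `Ω`). [folklore] -/
theorem contMDiffOn_inv : ContMDiffOn (𝓡 3) 𝓘(ℝ, 𝔼 3) ∞ Φ.inv (Φ.Γ '' Φ.Ω) := by
  rintro _ ⟨p, hp, rfl⟩
  obtain ⟨e, hpe, heq⟩ := Φ.isLocalDiffeomorphAt p hp
  -- restrict the witness to `Ω`
  set e' := e.toOpenPartialHomeomorph.restrOpen Φ.Ω Φ.isOpen_Ω with he'
  have hsrc : e'.source = e.source ∩ Φ.Ω := by rw [he', OpenPartialHomeomorph.restrOpen_source]; rfl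
  have hpe' : p ∈ e'.source := by rw [hsrc]; exact ⟨hpe, hp⟩
  have hye' : e' p ∈ e'.target := e'.map_source hpe'
  have hep : e' p = Φ.Γ p := (heq hpe).symm
  -- `inv = e'.symm` on the open neighbourhood `e'.target ∩ Γ '' Ω` of `Γ p`
  have hagree : ∀ y ∈ e'.target ∩ Φ.Γ '' Φ.Ω, Φ.inv y = e'.symm y := by
    rintro y ⟨hyt, hyΩ⟩
    have h1 : e'.symm y ∈ e'.source := e'.map_target hyt
    rw [hsrc] at h1
    have h2 : Φ.Γ (e'.symm y) = y := by
      rw [heq h1.1]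
      exact e'.right_inv hyt
    exact Φ.injOn (Φ.inv_mem hyΩ) h1.2 ((Φ.apply_inv hyΩ).trans h2.symm)
  have hnhds : e'.target ∩ Φ.Γ '' Φ.Ω ∈ 𝓝 (Φ.Γ p) :=
    (e'.open_target.inter Φ.isOpen_image_Ω).mem_nhds ⟨hep ▸ hye', ⟨p, hp, rfl⟩⟩
  have hsymm : ContMDiffAt (𝓡 3) 𝓘(ℝ, 𝔼 3) ∞ e'.symm (Φ.Γ p) := by
    have h1 : ContMDiffOn (𝓡 3) 𝓘(ℝ, 𝔼 3) ∞ e'.symm e'.target := by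
      rw [he']
      exact e.contMDiffOn_invFun.mono (by
        rw [OpenPartialHomeomorph.restrOpen_toPartialEquiv, PartialEquiv.restr_target]
        exact inter_subset_left)
    exact h1.contMDiffAt (e'.open_target.mem_nhds (hep ▸ hye'))
  exact (hsymm.congr_of_eventuallyEq (Filter.eventually_of_mem hnhds hagree)).contMDiffWithinAt

/-- The inverse is continuous on the image. [folklore] -/
theorem continuousOn_inv : ContinuousOn Φ.inv (Φ.Γ '' Φ.Ω) := Φ.contMDiffOn_inv.continuousOn

end Knot.FlatChart


/-! ### The data of the model over a flattening chart -/

section Data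

variable {K : Knot}

/-- **The data of the flat blow-down model over a flattening chart `Φ`, relative to `W`**: a
thickness `δ` and a smooth admissible cut-off of thickness `δ` whose compact support region lies
in the domain of the chart and is mapped into `W`. [folklore] -/
structure Knot.FlatChart.ModelData (Φ : K.FlatChart) (W : Set (𝕊 3)) where
  /-- The thickness of the flat tube. -/
  δ : ℝ
  /-- The admissible cut-off. -/
  C : Cutoff δ
  δ_pos : 0 < δ
  δ_le : δ ≤ 1 / 4
  contDiff_σ : ContDiff ℝ ∞ C.σ
  isCompact_supp : IsCompact C.supp
  supp_subset_Ω : C.supp ⊆ Φ.Ω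
  image_supp_subset : Φ.Γ '' C.supp ⊆ W
  /-- The size of a box around the flat disc inside the domain, at least the thickness. -/
  η : ℝ
  δ_le_η : δ ≤ η
  flatBox_subset_Ω : flatBox η ⊆ Φ.Ω

namespace Knot.FlatChart

variable (Φ : K.FlatChart) {W : Set (𝕊 3)}

/-- **Model data exist** for every open `W` containing the image of the flat disc: apply
`BlowDownFlat.exists_cutoff` to the open neighbourhood `Ω ∩ Γ⁻¹ W` of the flat disc. [folklore] -/
theorem nonempty_modelData (hW : IsOpen W) (hΦW : Φ.Γ '' BlowDownFlat.flatDisc ⊆ W) :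
    Nonempty (Φ.ModelData W) := by
  -- a box inside the domain
  obtain ⟨η, hη, -, hbox⟩ := exists_flatBox_subset Φ.isOpen_Ω Φ.flatDisc_subset
  -- the open neighbourhood of the flat disc to which the cut-off is adapted
  set W' : Set (𝔼 3) := (Φ.Ω ∩ Φ.Γ ⁻¹' W) ∩ {p | p 0 ^ 2 + p 1 ^ 2 < 1 + η ∧ |p 2| < η} with hW'
  have h0 := (contDiff_apply_euclidean (n := 3) 0).continuous
  have h1 := (contDiff_apply_euclidean (n := 3) 1).continuous
  have h2 := (contDiff_apply_euclidean (n := 3) 2).continuous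
  have hopen : IsOpen W' :=
    (Φ.continuousOn.isOpen_inter_preimage Φ.isOpen_Ω hW).inter
      ((isOpen_lt ((h0.pow 2).add (h1.pow 2)) continuous_const).inter
        (isOpen_lt h2.abs continuous_const))
  have hsub : BlowDownFlat.flatDisc ⊆ W' := fun p hp ↦
    ⟨⟨Φ.flatDisc_subset hp, hΦW ⟨p, hp, rfl⟩⟩, by linarith [hp.2], by rw [hp.1, abs_zero]; exact hη⟩
  obtain ⟨δ, C, hδ, hδ4, hσ, hc, hCW'⟩ := exists_cutoff hopen hsub
  -- the `δ`-tube lies in `W'`, hence `δ ≤ η`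
  have hδη : δ ≤ η := by
    by_contra hlt
    rw [not_le] at hlt
    set z : ℝ := (η + δ) / 2 with hz
    set p : 𝔼 3 := mk3 e0 z with hp
    have hpa : aFun p = 0 := by simp [aFun, hp, e0]
    have hpz : p 2 = z := rfl
    have hnorm : ‖az p‖ < δ := by
      have : ‖az p‖ ^ 2 < δ ^ 2 := by
        rw [norm_sq_eq_of_fin_two, az_apply_zero, az_apply_one, hpa, hpz]
        nlinarith
      exact abs_lt_of_sq_lt_sq' this hδ.le |>.2.trans_eq' (abs_of_nonneg (norm_nonneg _)).symm |>
        fun h ↦ by rwa [abs_of_nonneg (norm_nonneg _)] at h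
    have hmem : p ∈ C.supp := by
      by_contra h
      have := C.eq_one p h
      rw [C.eq_zero_of_tube p hnorm] at this
      norm_num at this
    have := (hCW' hmem).2.2
    rw [hpz, abs_lt] at this
    linarith [this.2]
  exact ⟨⟨δ, C, hδ, hδ4, hσ, hc, fun p hp ↦ (hCW' hp).1.1,
    image_subset_iff.2 fun p hp ↦ (hCW' hp).1.2, η, hδη, hbox⟩⟩

namespace ModelData

variable {Φ} (D : Φ.ModelData W)

/-- Where the cut-off is not `1`, we are in the support region. [folklore] -/
theorem mem_supp_of_σ_ne_one {p : 𝔼 3} (hp : D.C.σ p ≠ 1) : p ∈ D.C.supp := by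
  by_contra h
  exact hp (D.C.eq_one p h)

/-- The `δ`-tube lies in the support region. [folklore] -/
theorem mem_supp_of_norm_az_lt {p : 𝔼 3} (hp : ‖az p‖ < D.δ) : p ∈ D.C.supp :=
  D.mem_supp_of_σ_ne_one (by rw [D.C.eq_zero_of_tube p hp]; norm_num)

/-- The `δ`-tube lies in the domain of the chart. [folklore] -/
theorem mem_Ω_of_norm_az_lt {p : 𝔼 3} (hp : ‖az p‖ < D.δ) : p ∈ Φ.Ω :=
  D.supp_subset_Ω (D.mem_supp_of_norm_az_lt hp)

/-- The flat disc lies in the support region. [folklore] -/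
theorem flatDisc_subset_supp : BlowDownFlat.flatDisc ⊆ D.C.supp := fun p hp ↦
  D.mem_supp_of_σ_ne_one (by rw [D.C.eq_zero_of_disc p hp.1 hp.2]; norm_num)

/-- The flat circle lies in the support region. [folklore] -/
theorem flatCircle_mem_supp (u : 𝕊 1) : flatCircle u ∈ D.C.supp :=
  D.flatDisc_subset_supp ⟨rfl, (sphere_sq u).le⟩

/-- The image of the support region lies in `W`. [folklore] -/
theorem apply_mem_W {p : 𝔼 3} (hp : p ∈ D.C.supp) : Φ.Γ p ∈ W := D.image_supp_subset ⟨p, hp, rfl⟩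

/-- **The twist map preserves the domain of the chart** (off the flat circle): it preserves the
support region and is the identity off it. [folklore] -/
theorem twistMap_mem_Ω {s : ℝ} (hs : s ^ 2 = 1) {p : 𝔼 3} (hp : p ∈ Φ.Ω)
    (hpU : p ∉ range flatCircle) : twistMap D.C.σ s p ∈ Φ.Ω := by
  by_cases h : p ∈ D.C.supp
  · exact D.supp_subset_Ω ((D.C.twistMap_mem_supp_iff hs hpU).2 h)
  · rwa [D.C.twistMap_of_not_mem_supp s h]

/-- The twist map maps the support region into itself (off the flat circle). [folklore] -/
theorem twistMap_mem_supp {s : ℝ} (hs : s ^ 2 = 1) {p : 𝔼 3} (hp : p ∈ D.C.supp)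
    (hpU : p ∉ range flatCircle) : twistMap D.C.σ s p ∈ D.C.supp :=
  (D.C.twistMap_mem_supp_iff hs hpU).2 hp

end ModelData

end Knot.FlatChart

end Data

/-! ### The tubular neighbourhood of the model -/

section Nbhd

/-- **Reflecting the fibre changes the handedness of the flat tube**:
`flatTube h δ u (w₀, -w₁) = flatTube (-h) δ u w`. [folklore] -/
theorem BlowDownFlat.flatTube_planeFlip (h δ : ℝ) (u w : 𝔼 2) :
    flatTube h δ u (planeFlip w) = flatTube (-h) δ u w := by
  have hsq : squeeze δ (planeFlip w) = planeFlip (squeeze δ w) := by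
    rw [squeeze_def, squeeze_def, squeezeFactor_def, squeezeFactor_def, norm_planeFlip, map_smul]
  have h0 : squeeze δ (planeFlip w) 0 = squeeze δ w 0 := by rw [hsq, planeFlip_apply_zero]
  have h1 : squeeze δ (planeFlip w) 1 = -squeeze δ w 1 := by rw [hsq, planeFlip_apply_one]
  rw [flatTube, flatTube, tubeRadius, tubeRadius, h0, h1]
  congr 3
  ring

variable {K : Knot} {Φ : K.FlatChart} {W : Set (𝕊 3)} (D : Φ.ModelData W)

/-- `1² = 1` in `ℝ`. [folklore] -/
theorem _root_.Literature.Topology.FourManifolds.one_sq_eq : (1 : ℝ) ^ 2 = 1 := one_pow 2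

namespace Knot.FlatChart.ModelData

/-- The transported flat tube of handedness `h`: `Γ ∘ flatTubeS h δ`. [folklore] -/
def tubeMap (h : ℝ) (q : (𝕊 1) × 𝔼 2) : 𝕊 3 := Φ.Γ (flatTubeS h D.δ q)

/-- Unfolding of `tubeMap`. [folklore] -/
theorem tubeMap_apply (h : ℝ) (q : (𝕊 1) × 𝔼 2) : D.tubeMap h q = Φ.Γ (flatTubeS h D.δ q) := rfl

/-- The flat tube lands in the `δ`-tube, hence in the domain of the chart. [folklore] -/
theorem flatTubeS_mem_Ω {h : ℝ} (hh : h ^ 2 = 1) (q : (𝕊 1) × 𝔼 2) : flatTubeS h D.δ q ∈ Φ.Ω :=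
  D.mem_Ω_of_norm_az_lt ((flatTubePD hh D.δ_pos D.δ_le).map_source (mem_univ q))

/-- The flat tube lands in the support region. [folklore] -/
theorem flatTubeS_mem_supp {h : ℝ} (hh : h ^ 2 = 1) (q : (𝕊 1) × 𝔼 2) :
    flatTubeS h D.δ q ∈ D.C.supp :=
  D.mem_supp_of_norm_az_lt ((flatTubePD hh D.δ_pos D.δ_le).map_source (mem_univ q))

/-- The transported tube is smooth. [folklore] -/
theorem contMDiff_tubeMap {h : ℝ} (hh : h ^ 2 = 1) : ContMDiff 𝓘₁₂ (𝓡 3) ∞ (D.tubeMap h) :=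
  Φ.contMDiffOn.comp_contMDiff (contMDiff_flatTubeS hh D.δ_pos D.δ_le) (D.flatTubeS_mem_Ω hh)

/-- The transported tube is a local diffeomorphism. [folklore] -/
theorem isLocalDiffeomorph_tubeMap {h : ℝ} (hh : h ^ 2 = 1) :
    IsLocalDiffeomorph 𝓘₁₂ (𝓡 3) ∞ (D.tubeMap h) := fun q ↦
  IsLocalDiffeomorphAt.comp (hf := isLocalDiffeomorph_flatTubeS hh D.δ_pos D.δ_le q)
    (hg := Φ.isLocalDiffeomorphAt _ (D.flatTubeS_mem_Ω hh q))

/-- The transported tube is injective. [folklore] -/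
theorem tubeMap_injective {h : ℝ} (hh : h ^ 2 = 1) : Injective (D.tubeMap h) := fun q q' hqq' ↦
  flatTubeS_injective hh D.δ_pos D.δ_le
    (Φ.injOn (D.flatTubeS_mem_Ω hh q) (D.flatTubeS_mem_Ω hh q') hqq')

/-- The zero section of the flat tube is the flat circle. [folklore] -/
theorem _root_.Literature.Topology.FourManifolds.BlowDownFlat.flatTubeS_zero (h δ : ℝ) (u : 𝕊 1) :
    flatTubeS h δ (u, 0) = flatCircle u := by
  rw [flatTubeS_apply, flatTube, squeeze_zero, tubeRadius, squeeze_zero]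
  simp [flatCircle]

/-- The zero section of the transported tube is the knot. [folklore] -/
theorem tubeMap_zero (h : ℝ) (u : 𝕊 1) : D.tubeMap h (u, 0) = K u := by
  rw [tubeMap_apply, flatTubeS_zero, Φ.apply_flatCircle]

/-- **The oriented tubular neighbourhood of the model** (handedness fixed by the orientation of
the chart, `Knot.TubularNbhd.ofLocalDiffeomorph`). [folklore] -/
def nbhd : Knot.TubularNbhd K :=
  Knot.TubularNbhd.ofLocalDiffeomorph (D.isLocalDiffeomorph_tubeMap one_sq_eq)
    (D.tubeMap_injective one_sq_eq) (D.tubeMap_zero 1)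

open Classical in
/-- **The handedness of the model**: `1` if the transported right-handed flat tube is positively
oriented, `-1` otherwise. [folklore] -/
def hand : ℝ := if ∀ q, D.nbhd q = D.tubeMap 1 q then 1 else -1

/-- The handedness is `±1`. [folklore] -/
theorem hand_sq : D.hand ^ 2 = 1 := by
  unfold hand; split_ifs <;> norm_num

/-- **The tubular neighbourhood of the model is the transported flat tube of handedness `hand`.**
[folklore] -/
theorem nbhd_apply (q : (𝕊 1) × 𝔼 2) : D.nbhd q = Φ.Γ (flatTubeS D.hand D.δ q) := by
  unfold hand
  split_ifs with hc
  · exact hc q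
  · rcases Knot.TubularNbhd.ofLocalDiffeomorph_apply_or (D.isLocalDiffeomorph_tubeMap one_sq_eq)
      (D.tubeMap_injective one_sq_eq) (D.tubeMap_zero 1) with h1 | h2
    · exact absurd h1 hc
    · change Knot.TubularNbhd.ofLocalDiffeomorph _ _ _ q = _
      rw [h2 q, tubeMap_apply, flatTubeS_apply, flatTubeS_apply, flatTube_planeFlip]

/-- The range of the tubular neighbourhood of the model is the image of the `δ`-tube. [folklore] -/
theorem range_nbhd : range D.nbhd = Φ.Γ '' {p | ‖az p‖ < D.δ} := by
  rw [← range_flatTubeS D.hand_sq D.δ_pos D.δ_le, ← range_comp]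
  exact congrArg range (funext D.nbhd_apply)

/-- The range of the tubular neighbourhood of the model lies in `W`. [folklore] -/
theorem range_nbhd_subset : range D.nbhd ⊆ W := by
  rintro _ ⟨q, rfl⟩
  rw [D.nbhd_apply]
  exact D.apply_mem_W (D.flatTubeS_mem_supp D.hand_sq q)

variable (ε : ℤˣ)

/-- `ε² = 1` in `ℝ` for a unit `ε` of `ℤ`. [folklore] -/
theorem _root_.Literature.Topology.FourManifolds.units_int_sq_eq_one (ε : ℤˣ) : ((ε : ℤ) : ℝ) ^ 2 = 1 := by
  rcases Int.units_eq_one_or ε with h | h <;> simp [h]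

/-- **The framing-`ε` tubular neighbourhood of the model**: the twist by `ε` of `nbhd`
(`Knot.TubularNbhd.twist`). [folklore] -/
def nbhdε : Knot.TubularNbhd K := D.nbhd.twist ((ε : ℤ) : ℝ) (units_int_sq_eq_one ε)

/-- The framing-`ε` neighbourhood is the transported twisted flat tube. [folklore] -/
theorem nbhdε_apply (q : (𝕊 1) × 𝔼 2) :
    D.nbhdε ε q = Φ.Γ (twistedTube D.hand ((ε : ℤ) : ℝ) D.δ q.1 q.2) := by
  rw [nbhdε, Knot.TubularNbhd.twist_apply, D.nbhd_apply]
  rfl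

/-- The range of the framing-`ε` neighbourhood lies in `W`. [folklore] -/
theorem range_nbhdε_subset : range (D.nbhdε ε) ⊆ W := by
  rw [nbhdε, Knot.TubularNbhd.range_twist]
  exact D.range_nbhd_subset

end Knot.FlatChart.ModelData

end Nbhd

/-! ### The tubular neighbourhood of the model has framing `0` -/

section Framing

/-- The **slab** `{‖(x, y)‖ < R, 0 < z < z₁}` above the flat disc (an open convex set). [folklore] -/
def BlowDownFlat.slab (R z₁ : ℝ) : Set (𝔼 3) := {p | ‖xy p‖ < R ∧ 0 < p 2 ∧ p 2 < z₁}

namespace BlowDownFlat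

/-- `xy` is linear: compatibility with affine combinations. [folklore] -/
theorem xy_add_smul (a b : ℝ) (p q : 𝔼 3) : xy (a • p + b • q) = a • xy p + b • xy q := by
  ext i; fin_cases i <;> simp [xy]

/-- Strict convex combinations: `a x + b y < c` from `x < c`, `y < c`, `0 < a`, `0 ≤ b`,
`a + b = 1`. [folklore] -/
theorem convexCombo_lt {a b x y c : ℝ} (hx : x < c) (hy : y < c) (ha : 0 < a) (hb : 0 ≤ b)
    (hab : a + b = 1) : a * x + b * y < c := by
  have h1 : a * x < a * c := mul_lt_mul_of_pos_left hx ha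
  have h2 : b * y ≤ b * c := mul_le_mul_of_nonneg_left hy.le hb
  have h3 : a * c + b * c = c := by rw [← add_mul, hab, one_mul]
  linarith

/-- The slab is convex. [folklore] -/
theorem convex_slab (R z₁ : ℝ) : Convex ℝ (slab R z₁) := by
  intro p hp q hq a b ha hb hab
  obtain ⟨hp1, hp2, hp3⟩ := hp
  obtain ⟨hq1, hq2, hq3⟩ := hq
  rcases ha.eq_or_lt with rfl | ha'
  · rw [zero_add] at hab
    rw [hab, zero_smul, one_smul, zero_add]
    exact ⟨hq1, hq2, hq3⟩
  refine ⟨?_, ?_, ?_⟩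
  · rw [xy_add_smul]
    calc ‖a • xy p + b • xy q‖ ≤ ‖a • xy p‖ + ‖b • xy q‖ := norm_add_le _ _
      _ = a * ‖xy p‖ + b * ‖xy q‖ := by
        rw [norm_smul, norm_smul, Real.norm_of_nonneg ha, Real.norm_of_nonneg hb]
      _ < R := convexCombo_lt hp1 hq1 ha' hb hab
  · simp only [PiLp.add_apply, PiLp.smul_apply, smul_eq_mul]
    nlinarith [mul_pos ha' hp2, mul_nonneg hb hq2.le]
  · simp only [PiLp.add_apply, PiLp.smul_apply, smul_eq_mul]
    exact convexCombo_lt hp3 hq3 ha' hb hab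

/-- The slab is open. [folklore] -/
theorem isOpen_slab (R z₁ : ℝ) : IsOpen (slab R z₁) := by
  have h2 := (contDiff_apply_euclidean (n := 3) 2).continuous
  have : slab R z₁ = ({p | ‖xy p‖ < R} ∩ {p | 0 < p 2}) ∩ {p | p 2 < z₁} := by
    ext p; simp [slab, and_assoc]
  rw [this]
  exact ((isOpen_lt (contDiff_xy.continuous.norm) continuous_const).inter
    (isOpen_lt continuous_const h2)).inter (isOpen_lt h2 continuous_const)

/-- The slab of height at most `η` over the disc of radius `√(1 + η)` lies in the box `N_η`. [folklore] -/
theorem slab_subset_flatBox {η z₁ : ℝ} (hz₁ : z₁ ≤ η) :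
    slab (Real.sqrt (1 + η)) z₁ ⊆ flatBox η := by
  rintro p ⟨hp1, hp2, hp3⟩
  refine ⟨?_, ?_⟩
  · rw [sq_add_sq_eq_norm_xy_sq]
    have h1 : ‖xy p‖ ^ 2 < Real.sqrt (1 + η) ^ 2 := pow_lt_pow_left₀ hp1 (norm_nonneg _) two_ne_zero
    rw [Real.sq_sqrt (by linarith)] at h1
    exact h1.le
  · rw [abs_le]; constructor <;> linarith

/-- Points of a slab have positive height, so they are off the flat circle. [folklore] -/
theorem not_mem_range_flatCircle_of_mem_slab {R z₁ : ℝ} {p : 𝔼 3} (hp : p ∈ slab R z₁) :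
    p ∉ range flatCircle := fun h ↦ by
  rw [mem_range_flatCircle_iff] at h
  exact absurd h.2 hp.2.1.ne'

/-- **The height `z₀ = (σ_δ e₀)₀` of the longitude of the flat tube** (`e₀ = (½, 0)` the base
vector of the framing curve). [folklore] -/
def longitudeHeight (δ : ℝ) : ℝ := squeeze δ framingBaseVector 0

/-- The base vector of the framing curve in coordinates: `(½, 0)`. [folklore] -/
theorem framingBaseVector_apply_zero : framingBaseVector 0 = 1 / 2 := by
  simp [framingBaseVector, circlePoint_apply_zero]

/-- The base vector of the framing curve in coordinates: `(½, 0)`. [folklore] -/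
theorem framingBaseVector_apply_one : framingBaseVector 1 = 0 := by
  simp [framingBaseVector, circlePoint_apply_one]

/-- The squeezed base vector has vanishing second coordinate. [folklore] -/
theorem squeeze_framingBaseVector_apply_one (δ : ℝ) : squeeze δ framingBaseVector 1 = 0 := by
  rw [squeeze_def, PiLp.smul_apply, framingBaseVector_apply_one, smul_zero]

/-- The longitude height is `δ ρ(e₀) / 2`. [folklore] -/
theorem longitudeHeight_eq (δ : ℝ) : longitudeHeight δ = δ * squeezeFactor framingBaseVector / 2 := by
  rw [longitudeHeight, squeeze_def, PiLp.smul_apply, framingBaseVector_apply_zero, smul_eq_mul]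
  ring

/-- The longitude height is positive for `δ > 0`. [folklore] -/
theorem longitudeHeight_pos {δ : ℝ} (hδ : 0 < δ) : 0 < longitudeHeight δ := by
  rw [longitudeHeight_eq]
  exact div_pos (mul_pos hδ (squeezeFactor_pos _)) two_pos

/-- Twice the longitude height is less than `δ` (the squeeze factor is `< 1`). [folklore] -/
theorem two_mul_longitudeHeight_lt {δ : ℝ} (hδ : 0 < δ) : 2 * longitudeHeight δ < δ := by
  rw [longitudeHeight_eq]
  have h1 : squeezeFactor framingBaseVector < 1 := by
    rw [squeezeFactor_def]
    refine inv_lt_one_of_one_lt₀ ?_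
    rw [Real.lt_sqrt zero_le_one, one_pow]
    have := framingBaseVector_ne_zero
    have : 0 < ‖framingBaseVector‖ := norm_pos_iff.2 this
    nlinarith
  nlinarith [squeezeFactor_pos framingBaseVector]

/-- **The flat tube on the framing curve**: `flatTube h δ u e₀ = (u, z₀)`, the circle of radius
`1` at height `z₀`. [folklore] -/
theorem flatTube_framingBaseVector (h δ : ℝ) (u : 𝔼 2) :
    flatTube h δ u framingBaseVector = mk3 u (longitudeHeight δ) := by
  rw [flatTube, tubeRadius, squeeze_framingBaseVector_apply_one, mul_zero, mul_zero, add_zero,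
    Real.sqrt_one, one_smul, longitudeHeight]

end BlowDownFlat

variable {K : Knot} {Φ : K.FlatChart} {W : Set (𝕊 3)} (D : Φ.ModelData W)

namespace Knot.FlatChart.ModelData

/-- The slab of the model: radius `√(1 + η)`, height `2 z₀`. [folklore] -/
def slabSet : Set (𝔼 3) := slab (Real.sqrt (1 + D.η)) (2 * longitudeHeight D.δ)

/-- The slab of the model lies in the domain of the chart. [folklore] -/
theorem slabSet_subset_Ω : D.slabSet ⊆ Φ.Ω :=
  (slab_subset_flatBox ((two_mul_longitudeHeight_lt D.δ_pos).le.trans D.δ_le_η)).trans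
    D.flatBox_subset_Ω

/-- `0 < η` for the model data. [folklore] -/
theorem η_pos : 0 < D.η := D.δ_pos.trans_le D.δ_le_η

/-- The circle of radius `1` at height `z₀` lies in the slab of the model. [folklore] -/
theorem mk3_mem_slabSet (u : 𝕊 1) : mk3 u (longitudeHeight D.δ) ∈ D.slabSet := by
  refine ⟨?_, longitudeHeight_pos D.δ_pos, ?_⟩
  swap
  · change longitudeHeight D.δ < 2 * longitudeHeight D.δ
    linarith [longitudeHeight_pos D.δ_pos]
  rw [xy_mk3, norm_eq_of_mem_sphere u, Real.lt_sqrt zero_le_one, one_pow]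
  linarith [D.η_pos]

/-- The chart on the slab, with values in the knot complement, as a continuous map. [folklore] -/
def slabMap : C(D.slabSet, K.complement) where
  toFun q := ⟨Φ.Γ q, Φ.apply_mem_compl (D.slabSet_subset_Ω q.2)
    (not_mem_range_flatCircle_of_mem_slab q.2)⟩
  continuous_toFun :=
    (Φ.continuousOn.comp_continuous continuous_subtype_val fun q ↦ D.slabSet_subset_Ω q.2).subtype_mk _

/-- The slab map on points. [folklore] -/
@[simp] theorem coe_slabMap_apply (q : D.slabSet) : (D.slabMap q : 𝕊 3) = Φ.Γ q := rfl

/-- The base point of the slab: `(1, 0, z₀)`. [folklore] -/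
def slabBase : D.slabSet := ⟨mk3 (circlePoint 0 : 𝕊 1) (longitudeHeight D.δ), D.mk3_mem_slabSet _⟩

/-- **The flat longitude inside the slab**: the circle of radius `1` at height `z₀`, as a loop
in the slab based at `(1, 0, z₀)`. [folklore] -/
def slabLoop : Path D.slabBase D.slabBase where
  toFun θ := ⟨mk3 (circlePoint (2 * Real.pi * θ) : 𝕊 1) (longitudeHeight D.δ), D.mk3_mem_slabSet _⟩
  continuous_toFun := by
    refine Continuous.subtype_mk ?_ _
    exact contDiff_mk3.continuous.comp
      ((continuous_subtype_val.comp (contMDiff_circlePoint.continuous.comp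
        (continuous_const.mul continuous_subtype_val))).prodMk continuous_const)
  source' := by
    apply Subtype.ext
    simp only [Set.Icc.coe_zero, Knot.TubularNbhd.circlePoint_two_pi_mul_zero]; rfl
  target' := by
    apply Subtype.ext
    simp only [Set.Icc.coe_one, Knot.TubularNbhd.circlePoint_two_pi_mul_one]; rfl

/-- The slab map sends the base point of the slab to the base point of the neighbourhood. [folklore] -/
theorem slabMap_slabBase : D.slabMap D.slabBase = D.nbhd.basePoint := by
  apply Subtype.ext
  rw [coe_slabMap_apply, Knot.TubularNbhd.coe_basePoint, D.nbhd_apply, flatTubeS_apply,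
    flatTube_framingBaseVector]
  rfl

/-- **The longitude of the model neighbourhood is the image of the slab loop.** [folklore] -/
theorem longitude_nbhd : D.nbhd.longitude =
    ((D.slabLoop.map D.slabMap.continuous).cast D.slabMap_slabBase.symm D.slabMap_slabBase.symm) := by
  apply Path.ext
  funext θ
  apply Subtype.ext
  rw [Knot.TubularNbhd.coe_longitude_apply, D.nbhd_apply, flatTubeS_apply, flatTube_framingBaseVector]
  rfl

/-- **The slab loop is null-homotopic** (the slab is convex, hence contractible and simply
connected). [folklore] -/
theorem slabLoop_homotopic_refl : D.slabLoop.Homotopic (Path.refl D.slabBase) := by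
  haveI : ContractibleSpace D.slabSet :=
    (convex_slab _ _).contractibleSpace ⟨_, D.mk3_mem_slabSet (circlePoint 0)⟩
  exact SimplyConnectedSpace.paths_homotopic _ _

/-- **The model neighbourhood has framing `0`**: its longitude is the image of a null-homotopic
loop of the slab, so its class in `π₁(S³ ∖ K)` is trivial. [folklore] -/
theorem hasFraming_nbhd : D.nbhd.HasFraming 0 := by
  unfold Knot.TubularNbhd.HasFraming
  rw [zpow_zero, D.longitude_nbhd, Path.Homotopic.Quotient.mk_cast, Path.Homotopic.Quotient.mk_map,
    Path.Homotopic.Quotient.eq.2 D.slabLoop_homotopic_refl,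
    ← FundamentalGroup.mapOfEq_apply D.slabMap D.slabMap_slabBase, Path.Homotopic.Quotient.mk_refl,
    ← FundamentalGroup.one_def, map_one]
  exact map_one _

/-- **The framing-`ε` neighbourhood of the model has framing `ε`.** [folklore] -/
theorem hasFraming_nbhdε (ε : ℤˣ) : (D.nbhdε ε).HasFraming (ε : ℤ) := by
  have h := Knot.TubularNbhd.HasFraming.twist D.nbhd ((ε : ℤ) : ℝ) (units_int_sq_eq_one ε)
    D.hasFraming_nbhd (k := (ε : ℤ)) rfl
  rwa [zero_add] at h

end Knot.FlatChart.ModelData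

end Framing


/-! ### The twist of `S³ ∖ K` -/

section Twist

variable {K : Knot}

namespace Knot.FlatChart

variable (Φ : K.FlatChart)

/-- The image `V = Γ (Ω ∖ U)` of the punctured domain: an open subset of `S³ ∖ K`. [folklore] -/
def puncturedImage : Set (𝕊 3) := Φ.Γ '' (Φ.Ω \ range flatCircle)

/-- The image of the punctured domain is open. [folklore] -/
theorem isOpen_puncturedImage : IsOpen Φ.puncturedImage :=
  Φ.isOpen_image (Φ.isOpen_Ω.sdiff (by
    have h := isOpen_compl_range_flatCircle
    rwa [isOpen_compl_iff] at h)) sdiff_subset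

/-- Images of punctured-domain points lie in the punctured image. [folklore] -/
theorem apply_mem_puncturedImage {p : 𝔼 3} (hp : p ∈ Φ.Ω) (hpU : p ∉ range flatCircle) :
    Φ.Γ p ∈ Φ.puncturedImage := ⟨p, ⟨hp, hpU⟩, rfl⟩

/-- The punctured image misses the knot. [folklore] -/
theorem puncturedImage_subset_compl : Φ.puncturedImage ⊆ (range K)ᶜ := by
  rintro _ ⟨p, ⟨hp, hpU⟩, rfl⟩
  exact Φ.apply_mem_compl hp hpU

end Knot.FlatChart

variable {Φ : K.FlatChart} {W : Set (𝕊 3)} (D : Φ.ModelData W)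

namespace Knot.FlatChart.ModelData

/-- The image of the support region is compact. [folklore] -/
theorem isCompact_image_supp : IsCompact (Φ.Γ '' D.C.supp) :=
  D.isCompact_supp.image_of_continuousOn (Φ.continuousOn.mono D.supp_subset_Ω)

/-- A point of the image of the support region off the knot lies in the punctured image. [folklore] -/
theorem mem_puncturedImage_of_mem_image_supp {y : 𝕊 3} (hy : y ∈ Φ.Γ '' D.C.supp)
    (hyK : y ∉ range K) : y ∈ Φ.puncturedImage := by
  obtain ⟨p, hp, rfl⟩ := hy
  refine Φ.apply_mem_puncturedImage (D.supp_subset_Ω hp) fun hpU ↦ hyK ?_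
  obtain ⟨u, rfl⟩ := hpU
  exact ⟨u, (Φ.apply_flatCircle u).symm⟩

open Classical in
/-- **The twist of `S³` of sign `s`**: `Γ ∘ T_s ∘ Γ⁻¹` on the punctured image `Γ (Ω ∖ U)`, the
identity elsewhere (in particular on `K` and off the image of the support region; continuous off
`K` only). [folklore] -/
def sphereTwist (s : ℝ) (y : 𝕊 3) : 𝕊 3 :=
  if y ∈ Φ.puncturedImage then Φ.Γ (twistMap D.C.σ s (Φ.inv y)) else y

variable {D}

/-- **The twist of `S³` on the punctured image**: `Θ_s (Γ p) = Γ (T_s p)`. [folklore] -/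
theorem sphereTwist_apply (s : ℝ) {p : 𝔼 3} (hp : p ∈ Φ.Ω) (hpU : p ∉ range flatCircle) :
    D.sphereTwist s (Φ.Γ p) = Φ.Γ (twistMap D.C.σ s p) := by
  rw [sphereTwist, if_pos (Φ.apply_mem_puncturedImage hp hpU), Φ.inv_apply hp]

/-- Off the punctured image the twist of `S³` is the identity. [folklore] -/
theorem sphereTwist_of_not_mem (s : ℝ) {y : 𝕊 3} (hy : y ∉ Φ.puncturedImage) :
    D.sphereTwist s y = y := by
  rw [sphereTwist, if_neg hy]

/-- **Off the image of the support region the twist of `S³` is the identity.** [folklore] -/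
theorem sphereTwist_of_not_mem_image_supp (s : ℝ) {y : 𝕊 3} (hy : y ∉ Φ.Γ '' D.C.supp) :
    D.sphereTwist s y = y := by
  by_cases hV : y ∈ Φ.puncturedImage
  · obtain ⟨p, ⟨hp, hpU⟩, rfl⟩ := hV
    have hps : p ∉ D.C.supp := fun h ↦ hy ⟨p, h, rfl⟩
    rw [sphereTwist_apply s hp hpU, D.C.twistMap_of_not_mem_supp s hps]
  · exact sphereTwist_of_not_mem s hV

/-- The twist of `S³` maps the punctured image to itself (`s² = 1`). [folklore] -/
theorem sphereTwist_mem_puncturedImage {s : ℝ} (hs : s ^ 2 = 1) {y : 𝕊 3}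
    (hy : y ∈ Φ.puncturedImage) : D.sphereTwist s y ∈ Φ.puncturedImage := by
  obtain ⟨p, ⟨hp, hpU⟩, rfl⟩ := hy
  rw [sphereTwist_apply s hp hpU]
  exact Φ.apply_mem_puncturedImage (D.twistMap_mem_Ω hs hp hpU) (D.C.twistMap_not_mem hs hpU)

/-- **The twists of `S³` of opposite signs are inverse to each other** (`s² = 1`). [folklore] -/
theorem sphereTwist_neg_sphereTwist {s : ℝ} (hs : s ^ 2 = 1) (y : 𝕊 3) :
    D.sphereTwist (-s) (D.sphereTwist s y) = y := by
  by_cases hy : y ∈ Φ.puncturedImage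
  · obtain ⟨p, ⟨hp, hpU⟩, rfl⟩ := hy
    rw [sphereTwist_apply s hp hpU,
      sphereTwist_apply (-s) (D.twistMap_mem_Ω hs hp hpU) (D.C.twistMap_not_mem hs hpU),
      D.C.twistMap_neg_twistMap hs hpU]
  · rw [sphereTwist_of_not_mem s hy, sphereTwist_of_not_mem (-s) hy]

/-- The twist of sign `s` undoes that of sign `-s` (`s² = 1`). [folklore] -/
theorem sphereTwist_sphereTwist_neg {s : ℝ} (hs : s ^ 2 = 1) (y : 𝕊 3) :
    D.sphereTwist s (D.sphereTwist (-s) y) = y := by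
  have h := sphereTwist_neg_sphereTwist (D := D) (s := -s) (by rw [neg_sq, hs]) y
  rwa [neg_neg] at h

/-- The twist of `S³` maps the knot complement to itself (`s² = 1`). [folklore] -/
theorem sphereTwist_mem_compl {s : ℝ} (hs : s ^ 2 = 1) {y : 𝕊 3} (hy : y ∈ (range K)ᶜ) :
    D.sphereTwist s y ∈ (range K)ᶜ := by
  by_cases hV : y ∈ Φ.puncturedImage
  · exact Φ.puncturedImage_subset_compl (sphereTwist_mem_puncturedImage hs hV)
  · rwa [sphereTwist_of_not_mem s hV]

/-- **The twist of `S³` is smooth off the knot** (`s² = 1`): on the open punctured image it is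
`Γ ∘ T_s ∘ Γ⁻¹` with all three maps smooth there; off the compact image of the support region it
is the identity. [folklore] -/
theorem contMDiffAt_sphereTwist {s : ℝ} (hs : s ^ 2 = 1) {y : 𝕊 3} (hy : y ∈ (range K)ᶜ) :
    ContMDiffAt (𝓡 3) (𝓡 3) ∞ (D.sphereTwist s) y := by
  by_cases hV : y ∈ Φ.puncturedImage
  · -- on the punctured image
    have hev : D.sphereTwist s =ᶠ[𝓝 y] fun y ↦ Φ.Γ (twistMap D.C.σ s (Φ.inv y)) :=
      Filter.eventually_of_mem (Φ.isOpen_puncturedImage.mem_nhds hV) fun y' hy' ↦ by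
        rw [sphereTwist, if_pos hy']
    refine ContMDiffAt.congr_of_eventuallyEq ?_ hev
    obtain ⟨p, ⟨hp, hpU⟩, rfl⟩ := hV
    have hinv : ContMDiffAt (𝓡 3) 𝓘(ℝ, 𝔼 3) ∞ Φ.inv (Φ.Γ p) :=
      Φ.contMDiffOn_inv.contMDiffAt (Φ.isOpen_image_Ω.mem_nhds ⟨p, hp, rfl⟩)
    have hT : ContMDiffAt 𝓘(ℝ, 𝔼 3) 𝓘(ℝ, 𝔼 3) ∞ (twistMap D.C.σ s) (Φ.inv (Φ.Γ p)) := by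
      rw [Φ.inv_apply hp]
      exact (D.C.contDiffAt_twistMap D.contDiff_σ s hpU).contMDiffAt
    have hΓ : ContMDiffAt 𝓘(ℝ, 𝔼 3) (𝓡 3) ∞ Φ.Γ (twistMap D.C.σ s (Φ.inv (Φ.Γ p))) := by
      rw [Φ.inv_apply hp]
      exact Φ.contMDiffAt (D.twistMap_mem_Ω hs hp hpU)
    exact hΓ.comp (Φ.Γ p) (hT.comp (Φ.Γ p) hinv)
  · -- off the image of the support region: the identity
    have hys : y ∉ Φ.Γ '' D.C.supp := fun h ↦ hV (D.mem_puncturedImage_of_mem_image_supp h hy)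
    have hev : D.sphereTwist s =ᶠ[𝓝 y] id :=
      Filter.eventually_of_mem (D.isCompact_image_supp.isClosed.isOpen_compl.mem_nhds hys)
        fun y' hy' ↦ sphereTwist_of_not_mem_image_supp s hy'
    exact contMDiffAt_id.congr_of_eventuallyEq hev

variable (D)

/-- **The twist of the knot complement**: the restriction of the twist of `S³` of sign `s`
(`s² = 1`) to `S³ ∖ K`, a diffeomorphism of the open submanifold with inverse the twist of sign
`-s`. [folklore] -/
def complTwist {s : ℝ} (hs : s ^ 2 = 1) : K.complement ≃ₘ⟮𝓡 3, 𝓡 3⟯ K.complement where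
  toFun a := ⟨D.sphereTwist s a, sphereTwist_mem_compl hs a.2⟩
  invFun a := ⟨D.sphereTwist (-s) a, sphereTwist_mem_compl (by rw [neg_sq, hs]) a.2⟩
  left_inv a := Subtype.ext (sphereTwist_neg_sphereTwist hs _)
  right_inv a := Subtype.ext (sphereTwist_sphereTwist_neg hs _)
  contMDiff_toFun := by
    refine (ContMDiff.subtypeVal_comp_iff K.complement _).1 fun a ↦ ?_
    exact (contMDiffAt_sphereTwist hs a.2).comp a contMDiff_subtype_val.contMDiffAt
  contMDiff_invFun := by
    refine (ContMDiff.subtypeVal_comp_iff K.complement _).1 fun a ↦ ?_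
    exact (contMDiffAt_sphereTwist (by rw [neg_sq, hs]) a.2).comp a
      contMDiff_subtype_val.contMDiffAt

/-- The twist of the knot complement on points. [folklore] -/
@[simp] theorem coe_complTwist_apply {s : ℝ} (hs : s ^ 2 = 1) (a : K.complement) :
    (D.complTwist hs a : 𝕊 3) = D.sphereTwist s a := rfl

/-- **The gluing map of the knot complement**: the twist of `S³ ∖ K` followed by the inclusion.
[folklore] -/
def phiMap {s : ℝ} (hs : s ^ 2 = 1) : K.complement → 𝕊 3 := Subtype.val ∘ D.complTwist hs

/-- The gluing map of the complement on points. [folklore] -/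
theorem phiMap_apply {s : ℝ} (hs : s ^ 2 = 1) (a : K.complement) :
    D.phiMap hs a = D.sphereTwist s a := rfl

/-- The gluing map of the complement is a smooth embedding. [folklore] -/
theorem isSmoothEmbedding_phiMap {s : ℝ} (hs : s ^ 2 = 1) :
    Manifold.IsSmoothEmbedding (𝓡 3) (𝓡 3) ∞ (D.phiMap hs) :=
  isSmoothEmbedding_comp_diffeomorph (Manifold.IsSmoothEmbedding.of_opens K.complement)
    (D.complTwist hs)

/-- The range of the gluing map of the complement is the knot complement. [folklore] -/
theorem range_phiMap {s : ℝ} (hs : s ^ 2 = 1) : range (D.phiMap hs) = (range K)ᶜ := by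
  rw [phiMap, range_comp, (EquivLike.surjective (D.complTwist hs)).range_eq, image_univ,
    Subtype.range_coe]
  rfl

/-- The range of the gluing map of the complement is open. [folklore] -/
theorem isOpen_range_phiMap {s : ℝ} (hs : s ^ 2 = 1) : IsOpen (range (D.phiMap hs)) := by
  rw [D.range_phiMap hs]
  exact K.isClosed_range.isOpen_compl

/-- Off `W` the gluing map of the complement is the identity. [folklore] -/
theorem phiMap_of_not_mem_W {s : ℝ} (hs : s ^ 2 = 1) {a : K.complement} (ha : (a : 𝕊 3) ∉ W) :
    D.phiMap hs a = a :=
  sphereTwist_of_not_mem_image_supp s fun h ↦ ha (D.image_supp_subset h)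

/-- The gluing map of the complement maps `W ∖ K` into `W`. [folklore] -/
theorem phiMap_mem_W {s : ℝ} (hs : s ^ 2 = 1) {a : K.complement} (ha : (a : 𝕊 3) ∈ W) :
    D.phiMap hs a ∈ W := by
  rw [phiMap_apply]
  by_cases hV : (a : 𝕊 3) ∈ Φ.puncturedImage
  · obtain ⟨p, ⟨hp, hpU⟩, hpa⟩ := hV
    rw [← hpa, sphereTwist_apply s hp hpU]
    by_cases hps : p ∈ D.C.supp
    · exact D.apply_mem_W (D.twistMap_mem_supp hs hps hpU)
    · rw [D.C.twistMap_of_not_mem_supp s hps, hpa]; exact ha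
  · rw [sphereTwist_of_not_mem s hV]; exact ha

end Knot.FlatChart.ModelData

end Twist


/-! ### The new solid torus, the surgery relation and the covering -/

section Presentation

/-- Local notation: the model with corners of `ℝ² × S¹`. -/
local notation "𝓘₂₁" => (ModelWithCorners.prod 𝓘(ℝ, EuclideanSpace ℝ (Fin 2)) (𝓡 1))

variable {K : Knot} {Φ : K.FlatChart} {W : Set (𝕊 3)} (D : Φ.ModelData W) (ε : ℤˣ)

namespace Knot.FlatChart.ModelData

/-- **The sign of the twist**: `s = h ε` (handedness times framing sign). [folklore] -/
def sign : ℝ := D.hand * ((ε : ℤ) : ℝ)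

/-- The sign of the twist is `±1`. [folklore] -/
theorem sign_sq : D.sign ε ^ 2 = 1 := by
  rw [sign, mul_pow, D.hand_sq, units_int_sq_eq_one, one_mul]

/-- The flat `ψ` lands in the domain of the chart. [folklore] -/
theorem psiFlatS_mem_Ω (b : solidTorus) : psiFlatS D.hand ((ε : ℤ) : ℝ) D.δ b ∈ Φ.Ω :=
  D.mem_Ω_of_norm_az_lt (norm_az_psiFlatS_lt D.hand_sq (units_int_sq_eq_one ε) D.δ_pos D.δ_le b)

/-- The flat `ψ` lands in the support region. [folklore] -/
theorem psiFlatS_mem_supp (b : solidTorus) : psiFlatS D.hand ((ε : ℤ) : ℝ) D.δ b ∈ D.C.supp :=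
  D.mem_supp_of_norm_az_lt (norm_az_psiFlatS_lt D.hand_sq (units_int_sq_eq_one ε) D.δ_pos D.δ_le b)

/-- **The new solid torus of the model**: `ψ = Γ ∘ psiFlatS`. [folklore] -/
def psiMap (b : solidTorus) : 𝕊 3 := Φ.Γ (psiFlatS D.hand ((ε : ℤ) : ℝ) D.δ b)

/-- Unfolding of `psiMap`. [folklore] -/
theorem psiMap_apply (b : solidTorus) : D.psiMap ε b = Φ.Γ (psiFlatS D.hand ((ε : ℤ) : ℝ) D.δ b) := rfl

/-- `ψ` is smooth. [folklore] -/
theorem contMDiff_psiMap : ContMDiff 𝓘₂₁ (𝓡 3) ∞ (D.psiMap ε) :=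
  Φ.contMDiffOn.comp_contMDiff
    (contMDiff_psiFlatS D.hand_sq (units_int_sq_eq_one ε) D.δ_pos D.δ_le) (D.psiFlatS_mem_Ω ε)

/-- `ψ` is a local diffeomorphism. [folklore] -/
theorem isLocalDiffeomorph_psiMap : IsLocalDiffeomorph 𝓘₂₁ (𝓡 3) ∞ (D.psiMap ε) := fun b ↦
  IsLocalDiffeomorphAt.comp
    (hf := isLocalDiffeomorph_psiFlatS D.hand_sq (units_int_sq_eq_one ε) D.δ_pos D.δ_le b)
    (hg := Φ.isLocalDiffeomorphAt _ (D.psiFlatS_mem_Ω ε b))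

/-- `ψ` is injective. [folklore] -/
theorem psiMap_injective : Injective (D.psiMap ε) := fun b b' h ↦
  psiFlatS_injective D.hand_sq (units_int_sq_eq_one ε) D.δ_pos D.δ_le
    (Φ.injOn (D.psiFlatS_mem_Ω ε b) (D.psiFlatS_mem_Ω ε b') h)

/-- **`ψ` is a smooth embedding.** [folklore] -/
theorem isSmoothEmbedding_psiMap : Manifold.IsSmoothEmbedding 𝓘₂₁ (𝓡 3) ∞ (D.psiMap ε) :=
  isSmoothEmbedding_of_isLocalDiffeomorph (D.isLocalDiffeomorph_psiMap ε) (D.psiMap_injective ε)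
    solidTorusModelIso

/-- The range of `ψ` is open. [folklore] -/
theorem isOpen_range_psiMap : IsOpen (range (D.psiMap ε)) :=
  (D.isLocalDiffeomorph_psiMap ε).isOpen_range

/-- The range of `ψ` lies in `W`. [folklore] -/
theorem range_psiMap_subset : range (D.psiMap ε) ⊆ W := by
  rintro _ ⟨b, rfl⟩
  exact D.apply_mem_W (D.psiFlatS_mem_supp ε b)

/-- A twisted tube point over a unit vector at positive radius is off the flat circle. [folklore] -/
theorem twistedTube_not_mem_range (u v : 𝕊 1) {t : ℝ} (ht : 0 < t) :
    twistedTube D.hand ((ε : ℤ) : ℝ) D.δ u (t • (v : 𝔼 2)) ∉ range flatCircle := by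
  refine flatTube_not_mem_range D.hand_sq D.δ_pos D.δ_le u ?_
  rw [← norm_ne_zero_iff, norm_fibreRot_sphere (units_int_sq_eq_one ε), norm_smul,
    norm_eq_of_mem_sphere v, mul_one, Real.norm_of_nonneg ht.le]
  exact ht.ne'

/-- A twisted tube point lies in the domain of the chart. [folklore] -/
theorem twistedTube_mem_Ω (u : 𝕊 1) (w : 𝔼 2) :
    twistedTube D.hand ((ε : ℤ) : ℝ) D.δ u w ∈ Φ.Ω :=
  D.flatTubeS_mem_Ω D.hand_sq (u, fibreRot ((ε : ℤ) : ℝ) u w)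

/-- **The surgery relation of the model.** For `a ∈ S³ ∖ K` and `b` in the open solid torus:
`φ a = ψ b` iff `surgeryRel ν_ε a b` — the flat relation `twistMap_eq_psiFlat_iff` transported
along the (injective) chart. [folklore] -/
theorem phiMap_eq_psiMap_iff (a : K.complement) (b : solidTorus) :
    D.phiMap (D.sign_sq ε) a = D.psiMap ε b ↔ surgeryRel (D.nbhdε ε) a b := by
  have he := units_int_sq_eq_one ε
  constructor
  · intro hab
    rw [phiMap_apply, psiMap_apply] at hab
    by_cases hV : (a : 𝕊 3) ∈ Φ.puncturedImage
    · obtain ⟨p, ⟨hp, hpU⟩, hpa⟩ := hV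
      rw [← hpa, sphereTwist_apply _ hp hpU] at hab
      have hflat : twistMap D.C.σ (D.sign ε) p =
          psiFlat D.hand ((ε : ℤ) : ℝ) D.δ (b : (𝔼 2) × (𝕊 1)).1 (b : (𝔼 2) × (𝕊 1)).2 :=
        Φ.injOn (D.twistMap_mem_Ω (D.sign_sq ε) hp hpU) (D.psiFlatS_mem_Ω ε b) hab
      -- `b.1 ≠ 0`
      have hb0 : (b : (𝔼 2) × (𝕊 1)).1 ≠ 0 := by
        intro h0
        rw [h0] at hflat
        exact twistMap_ne_psiFlat_zero D.C D.hand_sq he (D.sign_sq ε) hpU _ hflat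
      set t : ℝ := ‖(b : (𝔼 2) × (𝕊 1)).1‖ with ht
      have htpos : 0 < t := norm_pos_iff.2 hb0
      have ht1 : t < 1 := (mem_solidTorus_iff _).1 b.2
      set u : 𝕊 1 := unitS (b : (𝔼 2) × (𝕊 1)).1 with hu
      have hbu : (b : (𝔼 2) × (𝕊 1)).1 = t • (u : 𝔼 2) := by
        rw [hu, coe_unitS, ht, norm_smul_unitVec]
      rw [hbu, sign, twistMap_eq_psiFlat_iff D.C D.hand_sq he D.δ_pos D.δ_le hpU u _ htpos] at hflat
      refine ⟨u, t, ⟨htpos, ht1⟩, hbu, ?_⟩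
      rw [← hpa, hflat, D.nbhdε_apply]
    · exfalso
      rw [sphereTwist_of_not_mem _ hV] at hab
      apply hV
      rw [hab]
      refine Φ.apply_mem_puncturedImage (D.psiFlatS_mem_Ω ε b) fun hU ↦ ?_
      have hK : Φ.Γ (psiFlatS D.hand ((ε : ℤ) : ℝ) D.δ b) ∈ range K := by
        rw [Φ.range_knot_eq]
        exact ⟨_, hU, rfl⟩
      exact a.2 (hab ▸ hK)
  · rintro ⟨u, t, ht, hbu, ha⟩
    rw [D.nbhdε_apply] at ha
    rw [phiMap_apply, psiMap_apply, ha,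
      sphereTwist_apply _ (D.twistedTube_mem_Ω ε u _) (D.twistedTube_not_mem_range ε u _ ht.1),
      sign, twistMap_twistedTube D.C D.hand_sq he D.δ_pos D.δ_le u _ ht.1, psiFlatS_apply, hbu]

/-- **The pieces of the model cover `S³`.** [folklore] -/
theorem range_phiMap_union_range_psiMap :
    range (D.phiMap (D.sign_sq ε)) ∪ range (D.psiMap ε) = univ := by
  have he := units_int_sq_eq_one ε
  refine eq_univ_of_forall fun y ↦ ?_
  by_cases hy : y ∈ Φ.Γ '' Φ.Ω
  · obtain ⟨p, hp, rfl⟩ := hy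
    rcases exists_eq_twistMap_or D.C D.hand_sq he (D.sign_sq ε) (δ := D.δ) p with
      ⟨a', ha'U, ha'p⟩ | ⟨v, hvp⟩
    · -- `p = T_s a'` with `a'` off the circle
      have ha'eq : a' = twistMap D.C.σ (-D.sign ε) p := by
        rw [← ha'p, D.C.twistMap_neg_twistMap (D.sign_sq ε) ha'U]
      have hpU : p ∉ range flatCircle := by
        rw [← ha'p]; exact D.C.twistMap_not_mem (D.sign_sq ε) ha'U
      have ha'Ω : a' ∈ Φ.Ω := by
        rw [ha'eq]
        exact D.twistMap_mem_Ω (by rw [neg_sq, D.sign_sq ε]) hp hpU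
      refine Or.inl ⟨⟨Φ.Γ a', Φ.apply_mem_compl ha'Ω ha'U⟩, ?_⟩
      rw [phiMap_apply]
      change D.sphereTwist (D.sign ε) (Φ.Γ a') = Φ.Γ p
      rw [sphereTwist_apply _ ha'Ω ha'U, ha'p]
    · refine Or.inr ⟨⟨((0 : 𝔼 2), v), by simp⟩, ?_⟩
      rw [psiMap_apply, psiFlatS_apply]
      exact congrArg Φ.Γ hvp
  · have hyK : y ∈ (range K)ᶜ := fun h ↦ hy (by
      rw [Φ.range_knot_eq] at h
      obtain ⟨q, ⟨u, rfl⟩, rfl⟩ := h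
      exact ⟨_, Φ.flatCircle_mem u, rfl⟩)
    have hyV : y ∉ Φ.puncturedImage := fun h ↦ hy (by
      obtain ⟨p, ⟨hp, -⟩, rfl⟩ := h
      exact ⟨p, hp, rfl⟩)
    refine Or.inl ⟨⟨y, hyK⟩, ?_⟩
    rw [phiMap_apply]
    exact sphereTwist_of_not_mem _ hyV

end Knot.FlatChart.ModelData

end Presentation

/-! ### The blow-down model from a flattening chart -/

section Main

open Knot.FlatChart.ModelData in
/-- **The blow-down model over a flattening chart.** If the knot `K` admits a flattening chart
`Φ` whose flat disc is mapped into the open set `W`, then for `ε = ±1` there are an oriented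
tubular neighbourhood `ν` of `K` with framing `ε` inside `W` and gluing maps `φ : S³ ∖ K → S³`,
`ψ : D̊² × S¹ → S³` presenting `S³` as the open gluing along `surgeryRel ν`, standard off `W`
(the conclusion of `Knot.blowDownModel`): transport of the flat model
(`BlowDownFlatModel.lean`) along `Φ`. Kirby (1989), Ch. I §5, Thm. 5.1, move (2); Rolfsen
(1976), §9.H. [cite: Kirby1989, Ch. I §5 Thm 5.1] -/
theorem Knot.FlatChart.blowDownModel {K : Knot} (Φ : K.FlatChart) (ε : ℤˣ) {W : Set (𝕊 3)}
    (hW : IsOpen W) (hΦW : Φ.Γ '' BlowDownFlat.flatDisc ⊆ W) :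
    ∃ ν : Knot.TubularNbhd K, ν.HasFraming ε ∧ range ν ⊆ W ∧
      ∃ (φ : K.complement → 𝕊 3) (ψ : solidTorus → 𝕊 3),
        Manifold.IsSmoothEmbedding (𝓡 3) (𝓡 3) ∞ φ ∧ IsOpen (range φ) ∧
        Manifold.IsSmoothEmbedding (𝓘(ℝ, 𝔼 2).prod (𝓡 1)) (𝓡 3) ∞ ψ ∧ IsOpen (range ψ) ∧
        range φ ∪ range ψ = univ ∧ (∀ a b, φ a = ψ b ↔ surgeryRel ν a b) ∧
        (∀ a : K.complement, (a : 𝕊 3) ∉ W → φ a = (a : 𝕊 3)) ∧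
        (∀ a : K.complement, (a : 𝕊 3) ∈ W → φ a ∈ W) ∧ range ψ ⊆ W := by
  obtain ⟨D⟩ := Φ.nonempty_modelData hW hΦW
  exact ⟨D.nbhdε ε, D.hasFraming_nbhdε ε, D.range_nbhdε_subset ε, D.phiMap (D.sign_sq ε),
    D.psiMap ε, D.isSmoothEmbedding_phiMap _, D.isOpen_range_phiMap _, D.isSmoothEmbedding_psiMap ε,
    D.isOpen_range_psiMap ε, D.range_phiMap_union_range_psiMap ε, D.phiMap_eq_psiMap_iff ε,
    fun a ha ↦ D.phiMap_of_not_mem_W _ ha, fun a ha ↦ D.phiMap_mem_W _ ha, D.range_psiMap_subset ε⟩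

/-- **Existence of flattening charts for smooth spanning discs** (the remaining input of leaf
(C)): every smooth disc `d` (`IsSmoothDisc d`) with boundary the knot `K` is flattened by a chart,
i.e. there is a flattening chart `Φ` of `K` with `Φ.Γ (x, 0) = d x` for `‖x‖ ≤ 1` — a
thickening of the disc along a normal field (Hirsch, *Differential Topology* (1976), Ch. 4 §5,
tubular neighbourhoods; Palais (1960) / Cerf for the uniqueness of discs, not needed here).
Stated as a hypothesis structure consumed by `Knot.blowDownModel_of_flatCharts`. [folklore] -/
def Knot.ExistsFlatChart : Prop :=
  ∀ (K : Knot) (d : 𝔼 2 → 𝕊 3), IsSmoothDisc d → (∀ x : 𝕊 1, d x = K x) →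
    ∃ Φ : K.FlatChart, ∀ x : 𝔼 2, ‖x‖ ≤ 1 → Φ.Γ (mk3 x 0) = d x

/-- **Leaf (C) `Knot.blowDownModel` from the existence of flattening charts.** [folklore] -/
theorem Knot.blowDownModel_of_flatCharts (H : Knot.ExistsFlatChart) : Knot.blowDownModel := by
  intro K d hd hdK ε W hW hdW
  obtain ⟨Φ, hΦ⟩ := H K d hd hdK
  refine Φ.blowDownModel ε hW ?_
  rintro _ ⟨p, ⟨hz, hr⟩, rfl⟩
  have hxy : ‖xy p‖ ≤ 1 := by
    rw [← Real.sqrt_sq (norm_nonneg _), ← sq_add_sq_eq_norm_xy_sq, Real.sqrt_le_one]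
    exact hr
  have hp : p = mk3 (xy p) 0 := by rw [← hz, mk3_xy]
  rw [hp, hΦ _ hxy]
  exact hdW ⟨xy p, by rwa [Metric.mem_closedBall, dist_zero_right], rfl⟩

end Main

end Literature.Topology.FourManifolds
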